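import Summits.HodgeConjecture.HodgeConjecture.Theses.TorelliForSymmetries
import Literature.AlgebraicGeometry.Motives.HodgeStructureK3Type
import Literature.AlgebraicGeometry.Motives.CorrespondencesAlgebraicOperators
import HarnessLib

/-!
# Route `TorelliForSymmetries`, glue `InvolutionsOfMiddle` (stmt-HodgeConjecture-14419)

`ReflectionsDecide → MiddleInvolutions → InvolutionsAreCorrespondences`. Given `B` (comparison
compatible, with the Künneth–Hodge clause `K`), `X` smooth projective of dimension `n` and an
involution `φ` of `Hⁱ_B(X)`: `K` gives a Hodge class `u ∈ Hdgⁿ_B(X × X)` inducing `φ`; `X × X` is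
smooth projective of dimension `n + n` (`IsSmoothProjective.tensor_holds`) with middle degree `2n`
and a polarization `P` of `H²ⁿ_B(X × X)` (`B.polarizable`); for every Hodge class `v` of
`H²ⁿ_B(X × X)` the `P`-reflection `s_v = id - (2/P(v,v)) P(·,v) v` is a `B`-Hodge endomorphism
(`reflection_mem_endAlg`: its complexification is `x ↦ x - P_ℂ(x, v) · (2/P(v,v)) v`, the correction
lies in `ℂ v ⊆ Fⁿ ⊆ Fᵃ` for `a ≤ n` and vanishes on `Fᵃ` for `a > n` by the first Hodge–Riemann
relation) with `s_v ∘ s_v = id` (`Module.involutive_preReflection`; in the junk case `P(v,v) = 0`,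
`2/0 = 0` and `s_v = id`); `MiddleInvolutions` at `Y = X × X` makes each `s_v` a correspondence, so
`ReflectionsDecide` gives `ℚ · Aⁿ_B(X × X) = Hdgⁿ_B(X × X) ∋ u`, and `ℚ · Aⁿ ⊆ Aⁿ ⊗ ℚ`
(`mem_ratAlgebraicClasses_of_mem_algebraicClasses`).
-/

set_option linter.dupNamespace false

noncomputable section

namespace Summit.HodgeConjecture.HodgeConjecture.Theorems

open CategoryTheory MonoidalCategory
open Literature.AlgebraicGeometry.Motives
open scoped TensorProduct

/-- Over `K = ℚ` the `ℚ`-span of the algebraic lattice lies in its divisible hull: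
`ℚ · Aᵖ(X) ⊆ Aᵖ(X) ⊗ ℚ` (`ratCast_smul_mem_ratAlgebraicClasses`). [folklore] -/
theorem mem_ratAlgebraicClasses_of_mem_algebraicClasses (W : WeilCohomology ℂ ℚ) (X : SchemeOver ℂ)
    (p : ℕ) {x : W.obj X (2 * p)} (hx : x ∈ W.algebraicClasses X p) :
    x ∈ W.ratAlgebraicClasses X p := by
  induction hx using Submodule.span_induction with
  | mem y hy => exact W.algebraicLattice_le_ratAlgebraicClasses X p hy
  | zero => exact AddSubgroup.zero_mem _
  | add y z _ _ hy hz => exact AddSubgroup.add_mem _ hy hz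
  | smul q y _ hy => simpa using W.ratCast_smul_mem_ratAlgebraicClasses hy q

section Reflection

variable {V : Type} [AddCommGroup V] [Module ℚ V] {m : ℤ} {H : HodgeStructure V m}

/-- The complexification of the rank-one map `y ↦ P(y, v) • w` is `x ↦ P_ℂ(x, 1 ⊗ v) • (1 ⊗ w)`.
[folklore] -/
theorem baseChange_smulRight_flip_apply (P : H.Polarization) (v w : V) (x : ℂ ⊗[ℚ] V) :
    ((P.form.flip v).smulRight w).baseChange ℂ x =
      (P.form.baseChange ℂ x (HodgeStructure.ofRat v)) • HodgeStructure.ofRat w := by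
  induction x using TensorProduct.induction_on with
  | zero => simp
  | tmul a y =>
    rw [LinearMap.baseChange_tmul, LinearMap.smulRight_apply, LinearMap.BilinForm.flip_apply,
      HodgeStructure.ofRat_apply, HodgeStructure.ofRat_apply,
      LinearMap.BilinForm.baseChange_tmul, mul_one, TensorProduct.smul_tmul',
      TensorProduct.tmul_smul, TensorProduct.smul_tmul', smul_eq_mul, mul_one]
  | add x y hx hy => rw [map_add, hx, hy, map_add, LinearMap.add_apply, add_smul]

/-- **The `P`-reflection in a Hodge class is an endomorphism of Hodge structures.** For a
polarization `P` of a Hodge structure of weight `m = 2k` and a rational Hodge class `v`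
(`1 ⊗ v ∈ Fᵏ`), `s_v = id - P(·, v) · c v` preserves the Hodge filtration after complexification:
on `Fᵃ`, `a ≤ k`, the correction lies in `ℂ (1 ⊗ v) ⊆ Fᵏ ⊆ Fᵃ`; for `a > k`, `P_ℂ(Fᵃ, 1 ⊗ v) = 0`
by the first Hodge–Riemann relation (`1 ⊗ v ∈ Fᵏ ⊆ F^{m+1-a}`).
[cite: VoisinHodgeI2002, §7.1.2 Def. 7.7 and §7.3.1] -/
theorem reflection_mem_endAlg (P : H.Polarization) {k : ℤ} (hk : k + k = m) {v : V}
    (hv : v ∈ H.hodgeClasses k) (c : ℚ) :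
    (LinearMap.id - (P.form.flip v).smulRight (c • v) : V →ₗ[ℚ] V) ∈ H.endAlg := by
  have hv' : HodgeStructure.ofRat v ∈ H.F k := hv
  refine Subalgebra.sub_mem _ (by rw [← Module.End.one_eq_id]; exact Subalgebra.one_mem _) ?_
  intro a
  rintro _ ⟨x, hx, rfl⟩
  rw [baseChange_smulRight_flip_apply, map_smul]
  by_cases ha : a ≤ k
  · exact Submodule.smul_mem _ _ (Submodule.smul_of_tower_mem _ c (H.antitone_F ha hv'))
  · have hva : HodgeStructure.ofRat v ∈ H.F (m + 1 - a) :=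
      H.antitone_F (show m + 1 - a ≤ k by omega) hv'
    rw [P.form_apply_eq_zero a x hx _ hva, zero_smul]
    exact Submodule.zero_mem _

/-- The `P`-reflection `s_v = id - P(·, v) (2/P(v,v)) v` is an involution (also in the junk case
`P(v,v) = 0`, where it is the identity). [folklore] -/
theorem reflection_comp_self (P : H.Polarization) (v : V) :
    (LinearMap.id - (P.form.flip v).smulRight ((2 / P.form v v) • v) : V →ₗ[ℚ] V) ∘ₗ
      (LinearMap.id - (P.form.flip v).smulRight ((2 / P.form v v) • v)) = LinearMap.id := by
  by_cases h0 : P.form v v = 0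
  · simp [h0]
  · have h2 : (P.form.flip v) ((2 / P.form v v) • v) = 2 := by
      rw [map_smul, LinearMap.BilinForm.flip_apply, smul_eq_mul, div_mul_cancel₀ _ h0]
    ext y
    exact Module.involutive_preReflection h2 y

end Reflection

/-- **Glue `InvolutionsOfMiddle` of route `TorelliForSymmetries`** (stmt-HodgeConjecture-14419):
`ReflectionsDecide → MiddleInvolutions → InvolutionsAreCorrespondences`. See the module docstring.
[cite: VoisinHodgeI2002, §7.1.2 and §11.3] [cite: Kleiman1968, §1.3–1.4] -/
theorem torelliForSymmetries_involutionsOfMiddle_proof :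
    Summit.HodgeConjecture.HodgeConjecture.Theses.TorelliForSymmetries.InvolutionsOfMiddle := by
  intro hRD hMI B hBcc hK n X hX i j' hj φ hφ
  have hXX : IsSmoothProjective (n + n) (X ⊗ X) := IsSmoothProjective.tensor_holds hX hX
  obtain ⟨u, hu, hind⟩ := hK hX hXX i j' hj φ
  refine ⟨u, ?_, hind⟩
  obtain ⟨P⟩ := B.polarizable hXX (2 * n)
  have hnn : (n : ℤ) + n = ((2 * n : ℕ) : ℤ) := by push_cast; ring
  -- every `P`-reflection in a Hodge class of `H²ⁿ_B(X × X)` is a correspondence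
  have hHC : B.HodgeConjectureFor hXX n := by
    refine hRD B hXX n P fun v hv j'' hj'' ↦ ?_
    let s : (B.hodge hXX (2 * n)).endAlg :=
      ⟨LinearMap.id - (P.form.flip v).smulRight ((2 / P.form v v) • v),
        reflection_mem_endAlg P hnn hv _⟩
    exact hMI B hBcc hK hXX (HodgeStructure.endAlg.toHom s) (reflection_comp_self P v) j'' hj''
  have huA : u ∈ B.W.algebraicClasses (X ⊗ X) n := by
    rw [hHC]; exact hu
  exact mem_ratAlgebraicClasses_of_mem_algebraicClasses B.W (X ⊗ X) n huA

end Summit.HodgeConjecture.HodgeConjecture.Theorems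

end
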